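import Summits.CriticalPhenomena.Ising3D.Control2DDataSet
import Summits.CriticalPhenomena.Ising3D.Control2DNonVacuity
import Mathlib.Tactic.Linarith
import Mathlib.Tactic.NormNum
import Mathlib.Tactic.FieldSimp
import Mathlib.Tactic.Ring
import HarnessLib

/-!
# Parity symmetry of the 2D expansion is bookkeeping, not a hypothesis: oriented crossing data
(cell `pub-ising3x`, seat controls-1 gen 41; PAPER §6.2 / Appendix E — CONTROL-ONLY; part 1 of 2, the transfer;
part 2 `Control2DParityRecord` instantiates the record and exhibits the oriented Ising witness)

HONEST FRAMING: lottery ticket; floor = tightest certified 3D Ising CFT bounds; no exact-solution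
claim without a proof. CONTROL-ONLY (`d = 2`, global `sl(2) × sl(2)` blocks, `Δ_σ = s` an INPUT, axiom set
`A2D′`); nothing here is about `d = 3`, no certificate, functional or number of the record is touched, and no
new hypothesis or named fact enters.

WHAT THIS FILE ADDS. The typed `CrossingData` of `Control2DBootstrap` enters the pair of quasi-primaries
`(h, h̄)`, `(h̄, h)` ONCE, with a common squared OPE coefficient `p` and the parity-symmetrised block
`g_{Δ,ℓ}(z,z̄) = k_{2h}(z) k_{2h̄}(z̄) + k_{2h̄}(z) k_{2h}(z̄)`; its docstring calls this «parity symmetry of the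
expansion built in — automatic in `d ≥ 3`, an assumption in `d = 2`, true for the 2D Ising CFT», and PAPER §6.2
says «unitary, parity-symmetric 2D CFT». This file shows the caveat costs nothing: every typed statement of the
2D record holds VERBATIM for expansions WITHOUT parity symmetry.

NORMALISATION IN WORDS (one convention throughout). The tree's typed block of a label `(Δ, ℓ)` is
`globalBlock Δ ℓ (z, z̄) = k_{2h}(z) k_{2h̄}(z̄) + k_{2h̄}(z) k_{2h}(z̄)`, `h = (Δ+ℓ)/2`, `h̄ = (Δ-ℓ)/2` — the SUM over both
orientations WITHOUT a factor `1/2` (`Control2DBootstrap`; for `ℓ = 0` it is `2 k_Δ(z) k_Δ(z̄)`), and a typed label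
carries the COMMON coefficient `p` of the pair. Consequently: an oriented label (ONE ordered pair, block `k k̄`,
coefficient `p`) enters the typed sum rule as the typed label `(Δ, ℓ)` with coefficient `p/2` (`OrientedData.symm`);
the typed total `(2,2)` coefficient (`T ⊕ T̄` entered once with `p_T = s²/(2c)`) is HALF the oriented total
`p_T + p_T̄`; and the typed in-box coefficient `p_box` (block `2 k k̄`) is HALF the oriented in-box total, which for a
scalar of squared OPE coefficient `λ²` (block `k_Δ(z) k_Δ(z̄) ∼ (z z̄)^{Δ/2}`, standard normalisation) is `λ²` itself —
E.1's «`λ² = 2 p_box`». `Control2DParityRecord` pins the convention on the 2D Ising datum: oriented totals `1/32`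
(`= p_T + p_T̄`) and `1/4` (`= λ²_{σσε}`), symmetrised `1/64` and `1/8` (the typed values).

* `orientedBlock Δ ℓ o` — the UNsymmetrised block `k_{2h}(z) k_{2h̄}(z̄)` of one ORDERED pair of weights,
  `(h, h̄) = ((Δ+ℓ)/2, (Δ-ℓ)/2)` for `o = true` and the reverse for `o = false`; `g_{Δ,ℓ}` is the sum of the two
  orientations, and swapping the arguments swaps the orientation (`globalBlock_split`).
* `OrientedData` — crossing data with INDEPENDENT left/right weights: each label carries `(Δ, ℓ, p)` and an
  orientation bit, i.e. one coefficient per ordered pair `(h, h̄)` (`p_{h,h̄} ≠ p_{h̄,h}`, or one of the two absent,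
  is allowed — no parity symmetry; integer spin `h - h̄ = ±ℓ` is built in, even `ℓ` is Bose symmetry of identical
  external scalars, `h, h̄ ≥ 0` and `p ≥ 0` are unitarity); its sum rule `Σ p F_-[k_{2h}(z)k_{2h̄}(z̄)] = -F_-[1]`
  on the open square (`OrientedData.SatisfiesCrossing`).
* SYMMETRISATION `D.symm : CrossingData` (same labels and `(Δ, ℓ)`, coefficient `p/2`): unitary if `D` is, and
  **it solves the typed sum rule at the same `s`** (`symm_satisfiesCrossing`): since `u = z z̄`, `v = (1-z)(1-z̄)`
  are symmetric, `F_-[g](z̄, z) = F_-[g ∘ swap](z, z̄)` (`crossF_swap`), so the typed sum rule at `(z, z̄)` is the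
  AVERAGE of the oriented sum rule at `(z, z̄)` and at `(z̄, z)`, both points of the square; same scalar / spin-2
  content and gaps (literally); total `(2,2)` coefficient and total in-box coefficient = HALF the oriented totals
  (`symm_stressCoeff`, `symm_boxCoeff`). In oriented bookkeeping `T` and `T̄` are two labels with the Ward values
  `p_T = s²/(2c_L)`, `p_T̄ = s²/(2c_R)` (Belavin–Polyakov–Zamolodchikov), and a scalar's block is `k_Δ(z) k_Δ(z̄)`,
  so the oriented in-box total IS `λ²_{σσ[box]}` in the standard normalisation.
* TRANSFER, each a few lines and each stated on the EXISTING typed predicates (no new named statement):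
  `GapExcluded.oriented`, `ExcludedAt.oriented`, `BoxExcluded.oriented`, `TwoSided.oriented`,
  `CTwoSided.oriented` (conclusion for the harmonic mean `2 c_L c_R/(c_L + c_R)`, `= c` when `c_L = c_R`),
  `PBoxTwoSided.oriented` (`2 lo < λ² < 2 hi`), `ControlDataSet.oriented`.

NOT claimed: anything about Virasoro symmetry, anything three-dimensional, any new bound; NOT claimed that
`c_L = c_R`, nor separate two-sided bounds on `c_L` and `c_R` — the transferred `c` statement bounds the harmonic
mean `2c_Lc_R/(c_L+c_R)` ONLY (which is `c` when `c_L = c_R = c`). Label-wise statements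
(`OpeBound`, a bound on EACH `(2,2)` label) are not restated: the symmetrisation splits a `T ⊕ T̄` pair over two
labels, so only the TOTAL-coefficient kinds (`CTwoSided`, `PBoxTwoSided`, the data set) transfer without a factor.
The converse reading (typed data as oriented data) and the record instantiated are in `Control2DParityRecord`.

References: R. Rattazzi, V. S. Rychkov, E. Tonni, A. Vichi, JHEP 12 (2008) 031, §3 eq. (3.6), §5
[cite: RattazziEtAl2008, §5]; F. A. Dolan, H. Osborn, Nucl. Phys. B 678 (2004) 491, §3 [cite: DolanOsborn2004, §3];
A. A. Belavin, A. M. Polyakov, A. B. Zamolodchikov, Nucl. Phys. B 241 (1984) 333, §3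
[cite: BelavinPolyakovZamolodchikov1984, §3]. Tree: `CrossingData`, `chiralBlock`, `globalBlock`, `GapExcluded`
(`Control2DBootstrap`), `crossF` (`Literature/…/ConformalBootstrap3D/SigmaEpsilonSystem`); `ScalarsIn`, `SpinTwoIn`,
`ExcludedAt`, `BoxExcluded`, `TwoSided` (`Control2DIsland`); `stressSet`, `stressCoeff`, `CTwoSided`
(`Control2DOpeTwoSided`); `boxSet`, `boxCoeff` (`Control2DOpeEpsTwoSided`), `PBoxTwoSided` (`Control2DOpeEpsRungs`);
`ControlDataSet` (`Control2DDataSet`); `chiralBlock_nonneg` (`Control2DNonVacuity`). Mathlib: `HasSum.add`,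
`HasSum.mul_left`, `HasSum.congr_fun`, `tsum_mul_left`, `tsum_congr`.
-/

namespace Summit.CriticalPhenomena.Ising3D.Control2D

open Set
open Literature.MathematicalPhysics.QuantumFieldTheory.ConformalBootstrap3D

/-! ### Oriented (unsymmetrised) blocks and the symmetry of `F_-` under `z ↔ z̄` -/

/-- **The oriented block of one ordered pair of weights**: `k_{2h}(z) k_{2h̄}(z̄)` with
`(h, h̄) = ((Δ+ℓ)/2, (Δ-ℓ)/2)` for orientation `true` and `((Δ-ℓ)/2, (Δ+ℓ)/2)` for `false`
(Dolan–Osborn 2004, §3: the `ε = 0` Casimir eigenfunctions before `x ↔ z` symmetrisation).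
[cite: DolanOsborn2004, §3] -/
noncomputable def orientedBlock (Δ : ℝ) (ℓ : ℕ) : Bool → ℝ → ℝ → ℝ
  | true => fun z zb => chiralBlock ((Δ + ℓ) / 2) z * chiralBlock ((Δ - ℓ) / 2) zb
  | false => fun z zb => chiralBlock ((Δ - ℓ) / 2) z * chiralBlock ((Δ + ℓ) / 2) zb

/-- The parity-symmetrised block is the sum of the two orientations at the same point (as functions).
[cite: DolanOsborn2004, §3] -/
theorem globalBlock_eq_orientedBlock_add (Δ : ℝ) (ℓ : ℕ) :
    globalBlock Δ ℓ = fun z zb => orientedBlock Δ ℓ true z zb + orientedBlock Δ ℓ false z zb := by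
  funext z zb; simp only [globalBlock, orientedBlock]

/-- Swapping the arguments of an oriented block swaps its orientation. [folklore] -/
theorem orientedBlock_swap (Δ : ℝ) (ℓ : ℕ) (o : Bool) (z zb : ℝ) :
    orientedBlock Δ ℓ o zb z = orientedBlock Δ ℓ (!o) z zb := by
  cases o <;> simp only [orientedBlock, Bool.not_true, Bool.not_false] <;> ring

/-- **Splitting of the symmetrised block along one orientation**: for either `o`,
`g_{Δ,ℓ}(z, z̄) = b_o(z, z̄) + b_o(z̄, z)` as functions. [cite: DolanOsborn2004, §3] -/
theorem globalBlock_split (Δ : ℝ) (ℓ : ℕ) (o : Bool) :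
    globalBlock Δ ℓ = fun z zb => orientedBlock Δ ℓ o z zb + orientedBlock Δ ℓ o zb z := by
  funext z zb
  cases o <;> simp only [globalBlock, orientedBlock] <;> ring

/-- Both weights of a unitary label are non-negative: `Δ ≥ ℓ ≥ 0` gives `(Δ ± ℓ)/2 ≥ 0`. [folklore] -/
theorem weights_nonneg {Δ : ℝ} {ℓ : ℕ} (hΔ : (ℓ : ℝ) ≤ Δ) : 0 ≤ (Δ + ℓ) / 2 ∧ 0 ≤ (Δ - ℓ) / 2 := by
  have hℓ : (0 : ℝ) ≤ ℓ := Nat.cast_nonneg ℓ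
  constructor <;> linarith

/-- Oriented blocks of unitary labels are non-negative on the open square. [folklore] -/
theorem orientedBlock_nonneg {Δ : ℝ} {ℓ : ℕ} (hΔ : (ℓ : ℝ) ≤ Δ) (o : Bool) {z zb : ℝ}
    (hz : z ∈ Ioo (0 : ℝ) 1) (hzb : zb ∈ Ioo (0 : ℝ) 1) : 0 ≤ orientedBlock Δ ℓ o z zb := by
  obtain ⟨h1, h2⟩ := weights_nonneg hΔ
  cases o
  · exact mul_nonneg (chiralBlock_nonneg h2 hz) (chiralBlock_nonneg h1 hzb)
  · exact mul_nonneg (chiralBlock_nonneg h1 hz) (chiralBlock_nonneg h2 hzb)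

/-- An oriented block is at most the symmetrised block (the other orientation is non-negative). [folklore] -/
theorem orientedBlock_le_globalBlock {Δ : ℝ} {ℓ : ℕ} (hΔ : (ℓ : ℝ) ≤ Δ) (o : Bool) {z zb : ℝ}
    (hz : z ∈ Ioo (0 : ℝ) 1) (hzb : zb ∈ Ioo (0 : ℝ) 1) :
    orientedBlock Δ ℓ o z zb ≤ globalBlock Δ ℓ z zb := by
  rw [globalBlock_split Δ ℓ o]
  have h := orientedBlock_nonneg hΔ o hzb hz
  show orientedBlock Δ ℓ o z zb ≤ orientedBlock Δ ℓ o z zb + orientedBlock Δ ℓ o zb z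
  linarith

/-- **`F_-` at the swapped point is `F_-` of the swapped function**: `F^{s}_{σ}[g](z̄, z) = F^{s}_{σ}[g ∘ swap](z, z̄)`,
because `u = z z̄` and `v = (1-z)(1-z̄)` are symmetric. [folklore] -/
theorem crossF_swap (s σ : ℝ) (g : ℝ → ℝ → ℝ) (z zb : ℝ) :
    crossF s σ g zb z = crossF s σ (fun a b => g b a) z zb := by
  simp only [crossF]
  rw [mul_comm (1 - zb) (1 - z), mul_comm zb z]

/-- `F_-[1]` is symmetric under `z ↔ z̄`. [folklore] -/
theorem crossF_one_swap (s σ : ℝ) (z zb : ℝ) :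
    crossF s σ (fun _ _ => (1 : ℝ)) zb z = crossF s σ (fun _ _ => (1 : ℝ)) z zb :=
  crossF_swap s σ (fun _ _ => (1 : ℝ)) z zb

/-- `F_-` is additive in the block (pointwise form). [folklore] -/
theorem crossF_add_apply (s σ : ℝ) (f g : ℝ → ℝ → ℝ) (z zb : ℝ) :
    crossF s σ (fun a b => f a b + g a b) z zb = crossF s σ f z zb + crossF s σ g z zb := by
  simp only [crossF]; ring

/-- **`F_-` of the symmetrised block = `F_-` of one orientation at `(z, z̄)` plus the same at `(z̄, z)`.**
[folklore] -/
theorem crossF_globalBlock_split (s σ Δ : ℝ) (ℓ : ℕ) (o : Bool) (z zb : ℝ) :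
    crossF s σ (globalBlock Δ ℓ) z zb =
      crossF s σ (orientedBlock Δ ℓ o) z zb + crossF s σ (orientedBlock Δ ℓ o) zb z := by
  rw [globalBlock_split Δ ℓ o, crossF_add_apply, ← crossF_swap s σ (orientedBlock Δ ℓ o) z zb]

/-! ### Oriented crossing data: one coefficient per ordered pair `(h, h̄)` -/

/-- **Crossing data WITHOUT parity symmetry.** A `CrossingData` record (labels with `Δ`, spin `ℓ`, squared OPE
coefficient `p`) together with an ORIENTATION per label: `true` means the label is the ordered pair
`(h, h̄) = ((Δ+ℓ)/2, (Δ-ℓ)/2)` with block `k_{2h}(z) k_{2h̄}(z̄)`, `false` the reversed pair. A parity-violating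
expansion has `p_{h,h̄} ≠ p_{h̄,h}` (or only one of the two labels); integer spin `h - h̄ = ±ℓ ∈ ℤ` is built in; for
`ℓ = 0` the two orientations coincide. Rattazzi–Rychkov–Tonni–Vichi 2008, §3 (sum rule with `p ≥ 0`), read in
`d = 2` with independent left/right weights. [cite: RattazziEtAl2008, §3] -/
structure OrientedData extends CrossingData where
  /-- Orientation of each label: `true` ↦ `(h, h̄) = ((Δ+ℓ)/2, (Δ-ℓ)/2)`, `false` ↦ the reverse. -/
  orient : ι → Bool

namespace OrientedData

variable {D : OrientedData} {s : ℝ}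

/-- **Unitarity** of oriented data: `h, h̄ ≥ 0` (i.e. `Δ ≥ ℓ`), even `ℓ = |h - h̄|` (Bose symmetry of
identical external scalars), `p ≥ 0` — literally the clauses of `CrossingData.IsUnitary` on the underlying
record (the orientation does not enter). [cite: RattazziEtAl2008, §3] -/
def IsUnitary (D : OrientedData) : Prop :=
  D.toCrossingData.IsUnitary

/-- **The oriented sum rule at `Δ_σ = s`**: `Σ_i p_i F_-[k_{2h_i}(z) k_{2h̄_i}(z̄)](z, z̄) = -F_-[1](z, z̄)` as a
`HasSum` identity at every point of the open square — the `⟨σσσσ⟩` sum rule of Rattazzi–Rychkov–Tonni–Vichi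
2008, eq. (3.6), with unsymmetrised 2D blocks (no parity symmetry assumed). [cite: RattazziEtAl2008, §3 eq. (3.6)] -/
def SatisfiesCrossing (s : ℝ) (D : OrientedData) : Prop :=
  ∀ z zb : ℝ, z ∈ Ioo (0 : ℝ) 1 → zb ∈ Ioo (0 : ℝ) 1 →
    HasSum (fun i => D.p i * crossF s (-1) (orientedBlock (D.Δ i) (D.spin i) (D.orient i)) z zb)
      (-(crossF s (-1) (fun _ _ => (1 : ℝ)) z zb))

/-- **Symmetrisation**: the parity-symmetric `CrossingData` with the same labels and `(Δ, ℓ)` and HALF the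
coefficient on each label (the block data of `½ (𝒢(z, z̄) + 𝒢(z̄, z))`). [cite: RattazziEtAl2008, §3 eq. (3.6)] -/
noncomputable def symm (D : OrientedData) : CrossingData where
  ι := D.ι
  Δ := D.Δ
  spin := D.spin
  p := fun i => D.p i / 2

/-- `p` of the symmetrisation is `p/2` (`Δ`, `ℓ` and the label type are those of `D`, by `rfl`). [folklore] -/
@[simp] theorem symm_p (i : D.ι) : D.symm.p i = D.p i / 2 := rfl

/-- **Unitarity is inherited** by the symmetrisation (`p/2 ≥ 0`). [folklore] -/
theorem symm_isUnitary (h : D.IsUnitary) : D.symm.IsUnitary := by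
  intro i
  obtain ⟨he, hΔ, hp⟩ := h i
  exact ⟨he, hΔ, div_nonneg hp (by norm_num)⟩

/-- **The symmetrisation solves the TYPED sum rule at the same `s`.** At a point `(z, z̄)` of the square the
typed term is `(p/2) F_-[g](z,z̄) = ½ p F_-[b](z,z̄) + ½ p F_-[b](z̄,z)` (`crossF_globalBlock_split`), so the typed
sum rule is the average of the oriented sum rule at `(z, z̄)` and at `(z̄, z)` — both points of the square — with
value `½(-F_-[1](z,z̄)) + ½(-F_-[1](z̄,z)) = -F_-[1](z,z̄)` (`crossF_one_swap`). This is why parity symmetry of the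
expansion is bookkeeping and not a hypothesis of any typed 2D statement. [cite: RattazziEtAl2008, §3 eq. (3.6)] -/
theorem symm_satisfiesCrossing (h : D.SatisfiesCrossing s) : D.symm.SatisfiesCrossing s := by
  intro z zb hz hzb
  have A := (h z zb hz hzb).mul_left (1 / 2 : ℝ)
  have B := (h zb z hzb hz).mul_left (1 / 2 : ℝ)
  have AB := A.add B
  have hval : (1 / 2 : ℝ) * -(crossF s (-1) (fun _ _ => (1 : ℝ)) z zb) +
      (1 / 2 : ℝ) * -(crossF s (-1) (fun _ _ => (1 : ℝ)) zb z) = -(crossF s (-1) (fun _ _ => (1 : ℝ)) z zb) := by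
    rw [crossF_one_swap]; ring
  rw [hval] at AB
  refine AB.congr_fun fun i => ?_
  show D.p i / 2 * crossF s (-1) (globalBlock (D.Δ i) (D.spin i)) z zb = _
  rw [crossF_globalBlock_split s (-1) (D.Δ i) (D.spin i) (D.orient i)]
  ring

/-- Scalar content, spin-2 content and scalar gap of the symmetrisation are LITERALLY those of the underlying
record (the clauses do not mention `p` or the orientation). [folklore] -/
theorem symm_clauses {S : Set ℝ} {U : ℝ} :
    (D.symm.ScalarsIn S ↔ D.toCrossingData.ScalarsIn S) ∧ (D.symm.SpinTwoIn S ↔ D.toCrossingData.SpinTwoIn S) ∧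
      (D.symm.HasScalarGap U ↔ D.toCrossingData.HasScalarGap U) :=
  ⟨Iff.rfl, Iff.rfl, Iff.rfl⟩

/-- The `(2,2)`-indicator of the symmetrisation is half that of the underlying record (same `(2,2)` labels:
in oriented bookkeeping the `T`-type `(h,h̄) = (2,0)` and the `T̄`-type `(0,2)` labels). [folklore] -/
theorem symm_stress_indicator (i : D.ι) :
    D.symm.stressSet.indicator D.symm.p i = (1 / 2 : ℝ) * D.toCrossingData.stressSet.indicator D.p i := by
  unfold Set.indicator
  split_ifs with h1 h2 h2
  · rw [symm_p]; ring
  · exact (h2 h1).elim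
  · exact (h1 h2).elim
  · rw [mul_zero]

/-- **Total `(2,2)` coefficient of the symmetrisation = half the oriented total** `Σ_{(Δ,ℓ)=(2,2)} p`
(unconditional sums on both sides; with the Ward values `p_T = s²/(2c_L)`, `p_T̄ = s²/(2c_R)` of one `T` and one
`T̄` label this is `s²/(4c_L) + s²/(4c_R) = s²/(2c_h)`, `c_h` the harmonic mean).
[cite: BelavinPolyakovZamolodchikov1984, §3] -/
theorem symm_stressCoeff : D.symm.stressCoeff = D.toCrossingData.stressCoeff / 2 :=
  calc D.symm.stressCoeff = ∑' i : D.ι, D.symm.stressSet.indicator D.symm.p i := rfl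
    _ = ∑' i : D.ι, (1 / 2 : ℝ) * D.toCrossingData.stressSet.indicator D.p i := tsum_congr symm_stress_indicator
    _ = (1 / 2 : ℝ) * D.toCrossingData.stressCoeff := tsum_mul_left
    _ = D.toCrossingData.stressCoeff / 2 := by ring

/-- The in-box indicator of the symmetrisation is half that of the underlying record (same box, same scalar
labels). [folklore] -/
theorem symm_box_indicator (e₁ e₂ : ℝ) (i : D.ι) :
    (D.symm.boxSet e₁ e₂).indicator D.symm.p i = (1 / 2 : ℝ) * (D.toCrossingData.boxSet e₁ e₂).indicator D.p i := by
  unfold Set.indicator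
  split_ifs with h1 h2 h2
  · rw [symm_p]; ring
  · exact (h2 h1).elim
  · exact (h1 h2).elim
  · rw [mul_zero]

/-- **Total in-box coefficient of the symmetrisation = half the oriented in-box total.** In oriented
bookkeeping a scalar's block is `k_Δ(z) k_Δ(z̄) ∼ (z z̄)^{Δ/2}`, so the oriented in-box total is `λ²_{σσ[box]}`
itself (standard normalisation), and the typed `p_box = λ²/2`. [cite: RattazziEtAl2008, §3 eq. (3.6)] -/
theorem symm_boxCoeff (e₁ e₂ : ℝ) : D.symm.boxCoeff e₁ e₂ = D.toCrossingData.boxCoeff e₁ e₂ / 2 :=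
  calc D.symm.boxCoeff e₁ e₂ = ∑' i : D.ι, (D.symm.boxSet e₁ e₂).indicator D.symm.p i := rfl
    _ = ∑' i : D.ι, (1 / 2 : ℝ) * (D.toCrossingData.boxSet e₁ e₂).indicator D.p i :=
        tsum_congr (symm_box_indicator e₁ e₂)
    _ = (1 / 2 : ℝ) * D.toCrossingData.boxCoeff e₁ e₂ := tsum_mul_left
    _ = D.toCrossingData.boxCoeff e₁ e₂ / 2 := by ring

end OrientedData

/-! ### Transfer of the typed statements to oriented data -/

/-- **Transfer of `GapExcluded`**: no unitary ORIENTED solution at `Δ_σ = s` has all its scalars at `Δ ≥ U`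
(apply the typed statement to the symmetrisation). [cite: RattazziEtAl2008, §5] -/
theorem GapExcluded.oriented {s U : ℝ} (h : GapExcluded s U) (D : OrientedData) (hU : D.IsUnitary)
    (hC : D.SatisfiesCrossing s) : ¬ D.toCrossingData.HasScalarGap U :=
  fun hgap => h D.symm (OrientedData.symm_isUnitary hU) (OrientedData.symm_satisfiesCrossing hC) hgap

/-- **Transfer of `ExcludedAt`**: no unitary oriented `A2D′` datum at `Δ_σ = s` has its sub-gap scalars at the
location `x`. [cite: RattazziEtAl2008, §5] -/
theorem ExcludedAt.oriented {s G δ x : ℝ} (h : ExcludedAt s G δ x) (D : OrientedData) (hU : D.IsUnitary)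
    (hC : D.SatisfiesCrossing s) (hS : D.toCrossingData.ScalarsIn ({x} ∪ Ici G))
    (hT : D.toCrossingData.SpinTwoIn ({2} ∪ Ici (2 + δ))) : False :=
  h D.symm (OrientedData.symm_isUnitary hU) (OrientedData.symm_satisfiesCrossing hC) hS hT

/-- **Transfer of `BoxExcluded`.** [cite: RattazziEtAl2008, §5] -/
theorem BoxExcluded.oriented {s G δ e₁ e₂ : ℝ} (h : BoxExcluded s G δ e₁ e₂) (D : OrientedData)
    (hU : D.IsUnitary) (hC : D.SatisfiesCrossing s) (hS : D.toCrossingData.ScalarsIn (Icc e₁ e₂ ∪ Ici G))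
    (hT : D.toCrossingData.SpinTwoIn ({2} ∪ Ici (2 + δ))) : False :=
  h D.symm (OrientedData.symm_isUnitary hU) (OrientedData.symm_satisfiesCrossing hC) hS hT

/-- **Transfer of the class-1 item `TwoSided`**: every unitary oriented `A2D′` solution at `Δ_σ = s` whose
sub-gap scalars sit at one location `x ≥ w` has `ε_lo < x < U`. [cite: RattazziEtAl2008, §5] -/
theorem TwoSided.oriented {s G δ w εlo U : ℝ} (h : TwoSided s G δ w εlo U) (D : OrientedData)
    (hU : D.IsUnitary) (hC : D.SatisfiesCrossing s) (hT : D.toCrossingData.SpinTwoIn ({2} ∪ Ici (2 + δ)))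
    (x : ℝ) (hwx : w ≤ x) (hS : D.toCrossingData.ScalarsIn ({x} ∪ Ici G)) : εlo < x ∧ x < U :=
  h D.symm (OrientedData.symm_isUnitary hU) (OrientedData.symm_satisfiesCrossing hC) hT x hwx hS

/-- The harmonic mean of two positive numbers is positive and turns `s²/(2c_L) + s²/(2c_R)` into one Ward value:
`(s²/(2c_L) + s²/(2c_R))/2 = s²/(2 c_h)`, `c_h = 2c_Lc_R/(c_L+c_R)`. Elementary algebra. [folklore] -/
theorem harmonicMean_ward {s cL cR : ℝ} (hL : 0 < cL) (hR : 0 < cR) :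
    0 < 2 * cL * cR / (cL + cR) ∧
      (s ^ 2 / (2 * cL) + s ^ 2 / (2 * cR)) / 2 = s ^ 2 / (2 * (2 * cL * cR / (cL + cR))) := by
  refine ⟨by positivity, ?_⟩
  field_simp
  ring

/-- **Transfer of `CTwoSided`** (total `(2,2)` coefficient). Oriented Ward hypothesis: the datum has a `T`-type
label (`(h,h̄) = (2,0)`, block `k_4(z)`) with `p_T = s²/(2c_L)` and a `T̄`-type label (`(0,2)`, block `k_4(z̄)`) with
`p_T̄ = s²/(2c_R)` — this DEFINES `c_L, c_R > 0` from `p_T, p_T̄` (Belavin–Polyakov–Zamolodchikov: `⟨σσT⟩` is fixed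
by `h_σ = s/2` and `⟨TT⟩ = c_L/2`; a parity-violating theory may have `c_L ≠ c_R`) — and no other `(2,2)` content,
so that the ORIENTED total `(2,2)` coefficient is `s²/(2c_L) + s²/(2c_R)`; the hypothesis is stated on that total.
Conclusion: the HARMONIC MEAN `c_h = 2c_Lc_R/(c_L+c_R)` obeys `c_lo < c_h < c_hi` — and ONLY that: NOT claimed
`c_L = c_R`, nor separate two-sided bounds on `c_L`, `c_R` (when `c_L = c_R = c`, `c_h = c` and the typed reading
is recovered). [cite: BelavinPolyakovZamolodchikov1984, §3] -/
theorem CTwoSided.oriented {s G δ e₁ e₂ clo chi : ℝ} (h : CTwoSided s G δ e₁ e₂ clo chi) (D : OrientedData)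
    (hU : D.IsUnitary) (hC : D.SatisfiesCrossing s) (hS : D.toCrossingData.ScalarsIn (Icc e₁ e₂ ∪ Ici G))
    (hT : D.toCrossingData.SpinTwoIn ({2} ∪ Ici (2 + δ))) {cL cR : ℝ} (hL : 0 < cL) (hR : 0 < cR)
    (hW : D.toCrossingData.stressCoeff = s ^ 2 / (2 * cL) + s ^ 2 / (2 * cR)) :
    clo < 2 * cL * cR / (cL + cR) ∧ 2 * cL * cR / (cL + cR) < chi := by
  obtain ⟨hc, hward⟩ := harmonicMean_ward (s := s) hL hR
  refine h D.symm (OrientedData.symm_isUnitary hU) (OrientedData.symm_satisfiesCrossing hC) hS hT _ hc ?_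
  rw [OrientedData.symm_stressCoeff, hW, hward]

/-- **Transfer of `PBoxTwoSided`** (total in-box coefficient): the ORIENTED in-box total — `λ²_{σσ[box]}` in the
standard normalisation — lies in `(2 lo, 2 hi)`. [cite: RattazziEtAl2008, §5] -/
theorem PBoxTwoSided.oriented {s G δ e₁ e₂ lo hi : ℝ} (h : PBoxTwoSided s G δ e₁ e₂ lo hi) (D : OrientedData)
    (hU : D.IsUnitary) (hC : D.SatisfiesCrossing s) (hS : D.toCrossingData.ScalarsIn (Icc e₁ e₂ ∪ Ici G))
    (hT : D.toCrossingData.SpinTwoIn ({2} ∪ Ici (2 + δ))) :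
    2 * lo < D.toCrossingData.boxCoeff e₁ e₂ ∧ D.toCrossingData.boxCoeff e₁ e₂ < 2 * hi := by
  obtain ⟨h1, h2⟩ := h D.symm (OrientedData.symm_isUnitary hU) (OrientedData.symm_satisfiesCrossing hC) hS hT
  rw [OrientedData.symm_boxCoeff] at h1 h2
  constructor <;> linarith

/-- **Transfer of the three-datum data set**: for a unitary oriented `A2D′` datum with its sub-gap scalars at one
location `x ≥ w`: `ε_lo < x < ε_hi`; if its oriented total `(2,2)` coefficient is the Ward value
`s²/(2c_L) + s²/(2c_R)` then `c_lo < 2c_Lc_R/(c_L+c_R) < c_hi`; and its oriented in-box total (`= λ²`) lies in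
`(2 p_lo, 2 p_hi)`. [cite: RattazziEtAl2008, §5] -/
theorem ControlDataSet.oriented {s G δ w εlo εhi clo chi plo phi : ℝ}
    (h : ControlDataSet s G δ w εlo εhi clo chi plo phi) (D : OrientedData) (hU : D.IsUnitary)
    (hC : D.SatisfiesCrossing s) (hT : D.toCrossingData.SpinTwoIn ({2} ∪ Ici (2 + δ))) (x : ℝ) (hwx : w ≤ x)
    (hS : D.toCrossingData.ScalarsIn ({x} ∪ Ici G)) :
    (εlo < x ∧ x < εhi) ∧
      (∀ cL cR : ℝ, 0 < cL → 0 < cR →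
        D.toCrossingData.stressCoeff = s ^ 2 / (2 * cL) + s ^ 2 / (2 * cR) →
          clo < 2 * cL * cR / (cL + cR) ∧ 2 * cL * cR / (cL + cR) < chi) ∧
      (2 * plo < D.toCrossingData.boxCoeff εlo εhi ∧ D.toCrossingData.boxCoeff εlo εhi < 2 * phi) := by
  obtain ⟨hx, hc, hp⟩ :=
    h D.symm (OrientedData.symm_isUnitary hU) (OrientedData.symm_satisfiesCrossing hC) hT x hwx hS
  refine ⟨hx, ?_, ?_⟩
  · intro cL cR hL hR hW
    obtain ⟨hch, hward⟩ := harmonicMean_ward (s := s) hL hR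
    refine hc _ hch ?_
    rw [OrientedData.symm_stressCoeff, hW, hward]
  · rw [OrientedData.symm_boxCoeff] at hp
    obtain ⟨h1, h2⟩ := hp
    constructor <;> linarith

end Summit.CriticalPhenomena.Ising3D.Control2D
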